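import Summits.ValiantsHypothesis.ValiantsHypothesis.Theorems.BarrierLeverChowBenchmarkPairsPureSplittableChain
import Summits.ValiantsHypothesis.ValiantsHypothesis.Theorems.BarrierLeverChowBenchmarkPairsHaar

/-!
# Route BarrierLever — item 22038 `ChowBenchmarkPairs`, line `moore-peel`: CONJECTURE HAAR holds for every PENDANT-ORDERABLE row family
# (the chain theorem instantiated at the binary-code columns — an infinite sub-family of the registered node `stub_haar` in its own language)

Helper file (`--supports stmt-ValiantsHypothesis-22038`; cell valiant-natproofs, rung V4; seat val-np-p4 gen 23).  Closes NO item.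

`Stmt.haar` (node #6 of `Cruxes/ChowBenchmarkPairs/Lines/moore_peel.lean`, text = `…ChowBenchmarkHaar.Stmt.haar`): for every `h`, `n ≤ 2^h` and every
injective family of `n` row sets `S i ⊆ Fin h` of size `≤ 2`, some table makes `[segEntry P (S i) (benchCols h n j)]_{i,j<n}` nonsingular.  This file
proves the conclusion — with NO size or injectivity hypothesis — for every family admitting a PENDANT ORDERING: an enumeration in which every row
contains a point lying in no earlier row (`haar_of_pendant_order`).  Proof: the kernel chain theorem `exists_table_of_chain` (`…PureSplittableChain`,
THEOREM PS) with all weights `1` (`dirE_one`: the weighted entry is the segment entry) on the code columns, which form a chain because a later code is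
never a subset of an earlier one (`ChowBenchmarkHaar.benchCols_not_subset_of_lt`).  Covers: the point rows `{∅, {a₁}, …}` in any order after `∅`… more
precisely every forest-shaped family — paths, stars `{a b₁}, {a b₂}, …`, matchings, and their unions with fresh leaves — at every height.

WHAT THIS IS NOT: the clique rows of `stub_segmentMeanValue` have no pendant ordering beyond their third row; no stub is closed; nothing on crux
stmt-ValiantsHypothesis-14610 or on `VP` versus `VNP`.
-/

set_option linter.dupNamespace false

namespace Summit.ValiantsHypothesis.ValiantsHypothesis.Theorems.BarrierLever.ChowBenchmarkHaar

open Finset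
open Summit.ValiantsHypothesis.ValiantsHypothesis.Theorems.BarrierLever.MoorePeel (benchCols)
open Summit.ValiantsHypothesis.ValiantsHypothesis.Theorems.BarrierLever.ChowBenchmarkPeel (segE)
open Summit.ValiantsHypothesis.ValiantsHypothesis.Theorems.BarrierLever.ChowBenchmarkSplit (dirE dirE_one exists_table_of_chain)

/-- **HAAR for pendant-orderable families.**  If the rows `S t` (`t < n`) admit points `q t ∈ S t` with `q t ∉ S s` for all `s < t`, then for
`n ≤ 2^h` some table makes the matrix «these rows × the first `n` binary codes» nonsingular — the conclusion of `Stmt.haar` for this family. -/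
theorem haar_of_pendant_order (h n : ℕ) (S : Fin n → Finset (Fin h)) (q : Fin n → Fin h)
    (hq : ∀ t, q t ∈ S t) (hfresh : ∀ s t, s < t → q t ∉ S s) (hn : n ≤ 2 ^ h) :
    ∃ P : Fin h → Fin h → ℂ,
      (Matrix.of fun i j : Fin n =>
        ∑ g : (↥(benchCols h n j) → ↥(S i)), (∏ c : ↥(benchCols h n j), P (g c) c) *
          ∏ a : ↥(S i), ((Finset.univ.filter fun c : ↥(benchCols h n j) => g c = a).card.factorial : ℂ)).det ≠ 0 := by
  classical
  obtain ⟨P, hP⟩ := exists_table_of_chain (π := Fin h) (κ := Fin h) n S (fun _ _ => 1) (benchCols h n) q hq hfresh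
    (fun _ => le_refl 1) (fun s t hst => benchCols_not_subset_of_lt hn s t hst)
  refine ⟨P, ?_⟩
  have e : (Matrix.of fun i j : Fin n => dirE P (S i) ((fun _ _ => 1 : Fin n → Fin h → ℕ) i) (benchCols h n j)) =
      Matrix.of fun i j : Fin n =>
        ∑ g : (↥(benchCols h n j) → ↥(S i)), (∏ c : ↥(benchCols h n j), P (g c) c) *
          ∏ a : ↥(S i), ((Finset.univ.filter fun c : ↥(benchCols h n j) => g c = a).card.factorial : ℂ) := by
    refine Matrix.ext fun i j => ?_
    rw [Matrix.of_apply, Matrix.of_apply]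
    exact dirE_one P (S i) (benchCols h n j)
  rw [← e]
  exact hP

/-- **Example: stars.**  The rows `{a, b t}` (`t < n`) with `b` injective and `b t ≠ a` are pendant-orderable (fresh point `b t`), hence Haar. -/
theorem haar_of_star (h n : ℕ) (a : Fin h) (b : Fin n → Fin h) (hb : Function.Injective b) (hba : ∀ t, b t ≠ a) (hn : n ≤ 2 ^ h) :
    ∃ P : Fin h → Fin h → ℂ,
      (Matrix.of fun i j : Fin n =>
        ∑ g : (↥(benchCols h n j) → ↥(({a, b i} : Finset (Fin h)))), (∏ c : ↥(benchCols h n j), P (g c) c) *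
          ∏ a' : ↥(({a, b i} : Finset (Fin h))),
            ((Finset.univ.filter fun c : ↥(benchCols h n j) => g c = a').card.factorial : ℂ)).det ≠ 0 :=
  haar_of_pendant_order h n (fun t => ({a, b t} : Finset (Fin h))) b (fun t => by simp)
    (fun s t hst hmem => by
      rcases Finset.mem_insert.mp hmem with e | e
      · exact hba t e
      · exact (ne_of_lt hst).symm (hb (Finset.mem_singleton.mp e))) hn

end Summit.ValiantsHypothesis.ValiantsHypothesis.Theorems.BarrierLever.ChowBenchmarkHaar
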